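/-
Copyright (c) 2026 the pub-hodgecm-mathlib formalisation cell (harness21).  Prover seat hodgecm-mathlib-K2E1-p15 (g3), Track B ∕ K2-LIT, h413 = `stmt-HodgeConjecture-24833`,
R90-TF section S8 «ContSpec-n½» (ruling S8-R14 (iii) 2026-09-04T16:27:23Z: LAYER 2 of the #4′ road = LAYER 1 at the adelic datum with the three block-structure letters kept open by name;
this file is its GENERIC-DATUM stage — any `𝒢 : AdelicGroupData F`, any family of unipotent radicals `𝔓` — so that the `cmDatum L 2 Φ₂` print only plugs ★ HEAD″ p861008 and (B) by name).
-/
import Summits.HodgeConjecture.HodgeConjecture.Theorems.R90S8LeClosureOfBlockLetters        -- ★ p861918 (this seat, LAYER 1): `le_topologicalClosure_of_block_letters`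
import Summits.HodgeConjecture.HodgeConjecture.Theorems.K2E1CuspidalSpectrumUnitaryDefs     -- ★ `residualSubspace 𝒢 μ 𝔓 = L²_disc ⊓ (L²_cusp)ᗮ`, `isOrtho_cuspidalSubspace_residualSubspace`; brings ★ `cuspidalSubspace`, `ParabolicUnipotentData`
import HarnessLib

/-!
# S8 #4′ road, LAYER 2 (generic datum) — `R90S8ResidualLeClosureOfLevelLetters`: an irreducible closed subrepresentation `P ≤ L²_res(𝒢, 𝔓)` lies in `closure C` as soon as, level by level,
# `(L²_cusp)ᗮ ∩ L²^{(K′,ω)}` is exhausted by blocks `⊆ closure (atoms ⊕ lines)`, the irreducibles of `L²_res` carry no line mass, and the atoms lie in `C`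

Track B ∕ K2-LIT, crux h413 = `stmt-HodgeConjecture-24833`, route of record `HCCMUnconditional`; cell `hodgecm-mathlib`, R90-TF programme, section S8 «ContSpec-n½», socket #4′
`sock_S8_resH_spannedByCharLines` («`L²_res(U(Φ₂)) ≤ closure ⨆_ψ ℂ·(ψ∘det)`»).  THEOREMS ONLY (no `def`, no `instance`, no `notation`, no named-fact hypothesis, no `sorry`; default
heartbeats); lane `--supports stmt-HodgeConjecture-24833 --as helper` (count-neutral).  Closes no socket.

THE MATHEMATICS ([MoeglinWaldspurger1995, I.2.18, II.2.4, V.3.13]; [ReedSimonI1980, Thm. II.3]).  `L²_res := L²_disc ∩ (L²_cusp)ᗮ` (★ `residualSubspace`), so an irreducible closed `P ≤ L²_res`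
has `P ∩ L²^{(K′,ω)} ≤ (L²_cusp)ᗮ ∩ L²^{(K′,ω)}` (★ `isOrtho_cuspidalSubspace_residualSubspace`) for every level∕`K`-type index `i = (K′,ω)` with isotypic space `Iso i = L²^{(K′,ω)}`.  The E1
estate's C7 HEAD″ (★ p861008 at `U(J₂)`; here the letter (HEAD)) exhausts `(L²_cusp)ᗮ ∩ Iso i` by the closed span of pseudo-Eisenstein BLOCKS `Blk i b`; each block lies in `closure (At i b ⊔ Ln i
b)` — residue ATOMS and unitary-axis LINES (letter (E_blk), the level self-dual package «G9»); atoms are orthogonal to lines across the level (letter (O), from (O_blk) in-block + ★ R6 across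
blocks — `isOrtho_iSup_atoms_lines_of_blocks` below); an irreducible of `L²_res` has NO LINE MASS (letter (N_blk), D5′); its `K`-isotypic pieces are dense (letter (D)); and the atoms lie in
the target `C` (letter (L) — at `U(Φ₂)`: ★ (B) p861962∕p862022, `C = ⨆_ψ ℂ·(ψ∘det)`).  Then ★ LAYER 1 gives `P ≤ closure C`.
* §1 `iSup_topologicalClosure_le`, **`isOrtho_iSup_atoms_lines_of_blocks`** — (O) at a level from (O_blk) + `At, Ln ≤ Blk` + pairwise block orthogonality (★ R6's shape).
* §2 **`residual_le_topologicalClosure_of_level_letters`** — THE HEAD (generic `𝒢`, `𝔓`): letters (D), (HEAD), (E_blk), (O), (N_blk), (L) ⊢ `P ≤ closure C`.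
HONEST LABEL: HC_CM is proved only modulo the 7 printed citations (2 remaining named inputs: hLiu418 = `stmt-HodgeConjecture-24832`, h413 = `stmt-HodgeConjecture-24833`) until
rung 0 closes; REL ≠ ★ ≠ BUILT; this file asserts no named fact, is conditional by construction on its visible binders, and closes no socket; count-neutral.

## References
* [MoeglinWaldspurger1995] C. Mœglin, J.-L. Waldspurger, *Spectral Decomposition and Eisenstein Series* (1995), I.2.18, II.2.4, V.3.13.
* [ReedSimonI1980] M. Reed, B. Simon, *Methods of Modern Mathematical Physics I* (1980), Thm. II.3.
-/

set_option autoImplicit false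
set_option linter.dupNamespace false  -- the mandated namespace `…HodgeConjecture.HodgeConjecture.R90.S8` (LEAD #1 L1) repeats the summit's segment

noncomputable section

universe u

open MeasureTheory ContRepresentation
open Literature.NumberTheory.Automorphic
open Summit.HodgeConjecture.HodgeConjecture.Cruxes.H413.K2E1CuspidalSpectrumUnitary (residualSubspace isOrtho_cuspidalSubspace_residualSubspace)

namespace Summit.HodgeConjecture.HodgeConjecture.R90.S8

/-! ## §1 Small Hilbert-space glue: closures of spans, and (O) at a level from block orthogonality -/

section Glue

variable {E : Type*} [NormedAddCommGroup E] [InnerProductSpace ℂ E]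

/-- `⨆_b closure (X b) ≤ closure (⨆_b X b)`. [folklore] -/
theorem iSup_topologicalClosure_le {β : Type*} (X : β → Submodule ℂ E) :
    (⨆ b, (X b).topologicalClosure) ≤ (⨆ b, X b).topologicalClosure :=
  iSup_le fun b => Submodule.topologicalClosure_mono (le_iSup X b)

/-- **(O) at a level from the block letters**: if `At b, Ln b ≤ Blk b`, atoms are orthogonal to lines INSIDE each block ((O_blk)) and distinct blocks are orthogonal (★ R6's shape
`Pairwise (Blk b ⟂ Blk b′)`), then `(⨆ At) ⟂ (⨆ Ln)`. [cite: ReedSimonI1980, Thm. II.3] -/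
theorem isOrtho_iSup_atoms_lines_of_blocks {β : Type*} (Blk At Ln : β → Submodule ℂ E)
    (hAt : ∀ b, At b ≤ Blk b) (hLn : ∀ b, Ln b ≤ Blk b) (hOblk : ∀ b, At b ⟂ Ln b) (hR6 : Pairwise fun b b' => Blk b ⟂ Blk b') :
    (⨆ b, At b) ⟂ (⨆ b, Ln b) := by
  classical
  refine Submodule.isOrtho_iSup_left.mpr fun b => Submodule.isOrtho_iSup_right.mpr fun b' => ?_
  by_cases h : b = b'
  · subst h
    exact hOblk b
  · exact (hR6 h).mono (hAt b) (hLn b')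

end Glue

/-! ## §2 The head: an irreducible of `L²_res` inside `closure C` from the level letters -/

section Residual

variable {F : Type} [Field F] [NumberField F] (𝒢 : AdelicGroupData.{u} F) (μ : Measure 𝒢.automorphicQuotient) [𝒢.IsAutomorphicMeasure μ]
  (𝔓 : 𝒢.ParabolicUnipotentData)

/-- **LAYER 2 (generic datum) — `P ≤ closure C` for an irreducible closed subrepresentation `P ≤ L²_res(𝒢, 𝔓)`**, from the level letters: (D) density of the `K`-isotypic pieces `P ∩ Iso i`;
(HEAD) exhaustion of `(L²_cusp)ᗮ ∩ Iso i` by blocks (★ C7 HEAD″ p861008's conclusion shape at `U(J₂)`); (E_blk) `Blk ≤ closure (At ⊔ Ln)`; (O) `(⨆ At) ⟂ (⨆ Ln)` per level (§1 from (O_blk) +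
★ R6); (N_blk) no line mass for irreducibles of `L²_res` (D5′ shape); (L) `At ≤ C`.  Proof: `P ∩ Iso i ≤ (L²_cusp)ᗮ ∩ Iso i` (★ `isOrtho_cuspidalSubspace_residualSubspace`), closures of
closures, then ★ LAYER 1 `le_topologicalClosure_of_block_letters`. [cite: MoeglinWaldspurger1995, I.2.18, II.2.4, V.3.13] -/
theorem residual_le_topologicalClosure_of_level_letters
    (P : ClosedSubrep (𝒢.rightRegular μ)) (hP : P.toContRep.IsTopIrreducible) (hPres : P ≤ residualSubspace 𝒢 μ 𝔓)
    {ι : Type*} (Iso : ι → Submodule ℂ (𝒢.L2 μ)) {β : ι → Type*} (Blk At Ln : ∀ i, β i → Submodule ℂ (𝒢.L2 μ)) (C : Submodule ℂ (𝒢.L2 μ))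
    (hD : P.toSubmodule ≤ (⨆ i, P.toSubmodule ⊓ Iso i).topologicalClosure)
    (hHead : ∀ i, (𝒢.cuspidalSubspace μ 𝔓).toSubmoduleᗮ ⊓ Iso i ≤ (⨆ b, Blk i b).topologicalClosure)
    (hEblk : ∀ i b, Blk i b ≤ (At i b ⊔ Ln i b).topologicalClosure)
    (hO : ∀ i, (⨆ b, At i b) ⟂ (⨆ b, Ln i b))
    (hN : ∀ i b, ∀ W : ClosedSubrep (𝒢.rightRegular μ), W.toContRep.IsTopIrreducible → W ≤ residualSubspace 𝒢 μ 𝔓 → W.toSubmodule ⊓ Iso i ≤ (Ln i b)ᗮ)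
    (hL : ∀ i b, At i b ≤ C) :
    P.toSubmodule ≤ C.topologicalClosure := by
  -- `P ≤ L²_res ⟂ L²_cusp`
  have hPcusp : P.toSubmodule ≤ (𝒢.cuspidalSubspace μ 𝔓).toSubmoduleᗮ :=
    ((isOrtho_cuspidalSubspace_residualSubspace 𝒢 μ 𝔓).mono_right (ClosedSubrep.toSubmodule_le_iff.mpr hPres)).ge
  -- (E) for the pieces `Q i := P ∩ Iso i`
  have hE : ∀ i, P.toSubmodule ⊓ Iso i ≤ (⨆ b, (At i b ⊔ Ln i b)).topologicalClosure := by
    intro i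
    have h1 : P.toSubmodule ⊓ Iso i ≤ (𝒢.cuspidalSubspace μ 𝔓).toSubmoduleᗮ ⊓ Iso i := inf_le_inf_right _ hPcusp
    refine (h1.trans (hHead i)).trans (Submodule.topologicalClosure_minimal _ ?_ (Submodule.isClosed_topologicalClosure _))
    exact (iSup_mono fun b => hEblk i b).trans (iSup_topologicalClosure_le _)
  exact le_topologicalClosure_of_block_letters P.toSubmodule (fun i => P.toSubmodule ⊓ Iso i) At Ln C hD hE hO (fun i b => hN i b P hP hPres) hL

end Residual

end Summit.HodgeConjecture.HodgeConjecture.R90.S8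

end
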